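import Summits.ResolutionOfSingularities.ResolutionOfSingularities.Theses.HomologicalConductor
import Literature.RingTheory.CohomologyAnnihilator.AnnihilationOfCohomology
import Literature.RingTheory.CohomologyAnnihilator.ModuleDescentFiniteSubextension
import Summits.ResolutionOfSingularities.ResolutionOfSingularities.Theorems.HomologicalConductorStrictDropRegularDrop
import Summits.ResolutionOfSingularities.ResolutionOfSingularities.Theorems.HomologicalConductorStrictDropTowerShape
import Summits.ResolutionOfSingularities.ResolutionOfSingularities.Theorems.HomologicalConductorStrictDropStationaryRegular
import Summits.ResolutionOfSingularities.ResolutionOfSingularities.Theorems.HomologicalConductorStrictDropDimLEOne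
import Summits.ResolutionOfSingularities.ResolutionOfSingularities.Theorems.HomologicalConductorStrictDropAssembly
import HarnessLib

/-!
# Crux `StrictDrop` (stmt-ResolutionOfSingularities-16485), line `birth` — the composition made UNCONDITIONAL
# in the named fact (kernel ⟺ crux)

Route `ResolutionOfSingularities/HomologicalConductor`, crux #4 `StrictDrop` (along the canonical
normalised cohomology-annihilator blow-up tower `T₀ = loc A`, `T_(m+1) = loc (nrm (chart T_m))` of a
finitely generated `A ⊆ O ⊆ K = Frac A`, while `T_m` is singular some later stage carries a non-zero
annihilator of `O`-value strictly below all of `ca(T_m) ∖ 0`).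

The registered skeleton `Cruxes/StrictDrop/Lines/birth.lean` (v4, sha16 `0bb865f43b01e4a8`) has exactly
two `sorry`s: the kernel `stub_dichotomy_dimGETwo` and the named Literature fact `stub_singEqVCa`
(`Sig.stub_singEqVCa := Literature.RingTheory.CohomologyAnnihilator.singEqVCa_essFiniteType.{0}`,
Iyengar–Takahashi 2014, Thm. 5.4: `V(ca R) = Sing R` for localisations of finitely generated algebras
over a field).  That fact is now PROVED in the tree
(`Literature.RingTheory.CohomologyAnnihilator.singEqVCa_essFiniteType_holds`,
`Literature/RingTheory/CohomologyAnnihilator/ModuleDescentFiniteSubextension.lean`), so: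

* (`SingEqVCa.stub_singEqVCa`, `Theorems/HomologicalConductorStrictDropSingEqVCa.lean`, p794282 — the stub
  `stub_singEqVCa` closed; this file uses the Literature constant `singEqVCa_essFiniteType_holds` directly);
* `stationary_regular` — SB (`StationaryRegular.stub_stationary_regular`, p168965) with the fact
  DISCHARGED: a stationary stage of the canonical tower is a regular local ring, unconditionally;
* `dropOrFreeze_iff_strictDrop` — the landed `Assembly.dropOrFreeze_iff_strictDrop` (p169447) with the
  fact discharged: drop-or-freeze (the v3 stub `stub_dichotomy`, inlined) is EQUIVALENT to the crux;
* `strictDrop_of_dichotomy_dimGETwo` / `dichotomy_dimGETwo_of_strictDrop` /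
  `dichotomy_dimGETwo_iff_strictDrop` — the skeleton's composition `StrictDrop_of` with its second
  hypothesis discharged: the crux `StrictDrop` is now EQUIVALENT to the single remaining registered stub
  `stub_dichotomy_dimGETwo` (drop or freeze from a stage all of whose successors are singular of Krull
  dimension `≥ 2`), stated inline (definitionally the registered `Sig.stub_dichotomy_dimGETwo`, `Iff.rfl`).

Every statement is the route's `let`-telescope verbatim (plus the line's `let Shape`); no definitions.

References: S. B. Iyengar, R. Takahashi, *Annihilation of cohomology and strong generation of module
categories*, IMRN 2016 (arXiv 2014), Thm. 5.4 [`IyengarTakahashi2014`]; H. Matsumura, *Commutative Ring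
Theory*, Thm. 11.7 [`Matsumura1987`].
-/

noncomputable section

-- single-problem summit: the doubled namespace component `ResolutionOfSingularities` is forced
set_option linter.dupNamespace false

open Summit.ResolutionOfSingularities.ResolutionOfSingularities.Theses.HomologicalConductor (StrictDrop)

namespace Summit.ResolutionOfSingularities.ResolutionOfSingularities.Theorems.StrictDrop.Birth.KernelIff

/-- **SB unconditional: a stationary stage of the canonical tower is regular.** The landed stub
`StationaryRegular.stub_stationary_regular` (a frozen stage is normal with principal `ca`, so
`V(ca) = Sing`, Krull's principal ideal theorem and `R₁` force `ca = ⊤`) with its named-fact hypothesis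
discharged by `singEqVCa_essFiniteType_holds` (= `SingEqVCa.stub_singEqVCa`, p794282). [cite: IyengarTakahashi2014, Thm. 5.4] -/
theorem stationary_regular : ∀ p : ℕ, p.Prime → ∀ (k K : Type) [Field k] [CharP k p] [Field K] [Algebra k K] (O : ValuationSubring K) (A : Subalgebra k K), (∀ c : k, algebraMap k K c ∈ O) → A.FG → IsFractionRing ↥A K → A.toSubring ≤ O.toSubring → let ca : Subalgebra k K → Set K := fun A => {x : K | ∃ hx : x ∈ A, ∃ n : ℕ, ∀ i : ℕ, n ≤ i → ∀ (M N : ModuleCat.{0} ↥A), Module.Finite ↥A M → Module.Finite ↥A N → ∀ e : CategoryTheory.Abelian.Ext.{0} M N i, (⟨x, hx⟩ : ↥A) • e = 0}; let loc : Subalgebra k K → Subalgebra k K := fun A => Algebra.adjoin k {y : K | ∃ a ∈ A, ∃ s ∈ A, s⁻¹ ∈ O ∧ y = a * s⁻¹}; let chart : Subalgebra k K → Subalgebra k K := fun A => Algebra.adjoin k ((A : Set K) ∪ {y : K | ∃ c ∈ ca A, ∃ x ∈ ca A, x ≠ 0 ∧ (∀ c' ∈ ca A, c' * x⁻¹ ∈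 O) ∧ y = c * x⁻¹}); let nrm : Subalgebra k K → Subalgebra k K := fun B => Algebra.adjoin k {y : K | IsIntegral ↥B y}; let tower : Subalgebra k K → ℕ → Subalgebra k K := fun A m => @Nat.rec (fun _ => Subalgebra k K) (loc A) (fun _ B => loc (nrm (chart B))) m; let Shape : Subalgebra k K → Prop := fun T => (∃ B : Subalgebra k K, B.FG ∧ B ≤ T ∧ loc B = T ∧ ∀ t ∈ T, ∃ b ∈ B, ∃ s ∈ B, s⁻¹ ∈ O ∧ t = b * s⁻¹) ∧ IsNoetherianRing ↥T ∧ T.toSubring ≤ O.toSubring ∧ ∀ s ∈ T, s⁻¹ ∈ O → s⁻¹ ∈ T; (∀ m : ℕ, Shape (tower A m)) → ∀ n : ℕ, tower A (n + 1) = tower A n → IsRegularLocalRing ↥(tower A n) :=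
  StationaryRegular.stub_stationary_regular
    Literature.RingTheory.CohomologyAnnihilator.singEqVCa_essFiniteType_holds

/-- **Drop-or-freeze is EQUIVALENT to the crux `StrictDrop`, unconditionally** (the landed
`Assembly.dropOrFreeze_iff_strictDrop`, p169447, with Iyengar–Takahashi Thm. 5.4 discharged): from every
stage `m`, either the minimal `ca`-value drops strictly at a later stage or some stage `n ≥ m` is
stationary — iff — `StrictDrop`. The left side is verbatim the (inlined) v3 stub `stub_dichotomy`.
[cite: IyengarTakahashi2014, Thm. 5.4] -/
theorem dropOrFreeze_iff_strictDrop : (∀ p : ℕ, p.Prime → ∀ (k K : Type) [Field k] [CharP k p] [Field K] [Algebra k K] (O : ValuationSubring K) (A : Subalgebra k K), (∀ c : k, algebraMap k K c ∈ O) → A.FG → IsFractionRing ↥A K → A.toSubring ≤ O.toSubring → let ca : Subalgebra k K → Set K := fun A => {x : K | ∃ hx : x ∈ A, ∃ n : ℕ, ∀ i : ℕ, n ≤ i → ∀ (M N : ModuleCat.{0} ↥A), Module.Finite ↥A M → Module.Finite ↥A N → ∀ e : CategoryTheory.Abelian.Ext.{0} M N i, (⟨x, hx⟩ : ↥A) •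 e = 0}; let loc : Subalgebra k K → Subalgebra k K := fun A => Algebra.adjoin k {y : K | ∃ a ∈ A, ∃ s ∈ A, s⁻¹ ∈ O ∧ y = a * s⁻¹}; let chart : Subalgebra k K → Subalgebra k K := fun A => Algebra.adjoin k ((A : Set K) ∪ {y : K | ∃ c ∈ ca A, ∃ x ∈ ca A, x ≠ 0 ∧ (∀ c' ∈ ca A, c' * x⁻¹ ∈ O) ∧ y = c * x⁻¹}); let nrm : Subalgebra k K → Subalgebra k K := fun B => Algebra.adjoin k {y : K | IsIntegral ↥B y}; let tower : Subalgebra k K → ℕ → Subalgebra k K := fun A m => @Nat.rec (fun _ => Subalgebra k K) (loc A) (fun _ B => loc (nrm (chart B))) m; let Shape : Subalgebra k K → Prop := fun T => (∃ B : Subalgebra k K, B.FG ∧ B ≤ T ∧ loc B = T ∧ ∀ t ∈ T, ∃ b ∈ B, ∃ s ∈ B, s⁻¹ ∈ O ∧ t = b * s⁻¹) ∧ IsNoetherianRing ↥T ∧ T.toSubring ≤ O.toSubring ∧ ∀ s ∈ T, s⁻¹ ∈ O → s⁻¹ ∈ T; (∀ m : ℕ, Shape (tower A m)) → ∀ m :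 ℕ, (∃ m' : ℕ, m < m' ∧ ∃ y ∈ ca (tower A m'), y ≠ 0 ∧ ∀ x ∈ ca (tower A m), x ≠ 0 → y * x⁻¹ ∉ O) ∨ ∃ n : ℕ, m ≤ n ∧ tower A (n + 1) = tower A n) ↔ StrictDrop :=
  Assembly.dropOrFreeze_iff_strictDrop
    Literature.RingTheory.CohomologyAnnihilator.singEqVCa_essFiniteType_holds

/-- **The crux from its ONE remaining registered stub.** `StrictDrop` follows from the kernel
`stub_dichotomy_dimGETwo` alone (stated inline, definitionally the registered `Sig.stub_dichotomy_dimGETwo`):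
drop or freeze from a stage `m` all of whose successors `n ≥ m` are singular of Krull dimension `≥ 2`.
This is the skeleton's composition `StrictDrop_of` with its second hypothesis (IT14 Thm. 5.4) discharged,
over the landed stubs S0 (`TowerShape.stub_towerShape`, p168403), S1
(`DimLEOne.stub_dimLEOne_succ_regular`, p172767), SB (`stationary_regular` above) and SC
(`RegularDrop.stub_regular_drop`, p166871): at a singular stage `m`, if some stage `n ≥ m` is regular, SC
gives the witness at `n > m`; if some stage `n ≥ m` is singular of dimension `≤ 1`, the next one is
regular (S1) and SC gives the witness at `n + 1`; otherwise the kernel hands over the drop or a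
stationary `n ≥ m`, and the latter is regular (SB) — excluded. [cite: IyengarTakahashi2014, Thm. 5.4] -/
theorem strictDrop_of_dichotomy_dimGETwo : (∀ p : ℕ, p.Prime → ∀ (k K : Type) [Field k] [CharP k p] [Field K] [Algebra k K] (O : ValuationSubring K) (A : Subalgebra k K), (∀ c : k, algebraMap k K c ∈ O) → A.FG → IsFractionRing ↥A K → A.toSubring ≤ O.toSubring → let ca : Subalgebra k K → Set K := fun A => {x : K | ∃ hx : x ∈ A, ∃ n : ℕ, ∀ i : ℕ, n ≤ i → ∀ (M N : ModuleCat.{0} ↥A), Module.Finite ↥A M → Module.Finite ↥A N → ∀ e : CategoryTheory.Abelian.Ext.{0} M N i, (⟨x, hx⟩ : ↥A) • e = 0}; let loc : Subalgebra k K → Subalgebra k K := fun A => Algebra.adjoin k {y : K | ∃ a ∈ A, ∃ s ∈ A, s⁻¹ ∈ O ∧ y = a * s⁻¹}; let chart : Subalgebra k K → Subalgebra k K := fun A => Algebra.adjoin k ((A : Set K) ∪ {y : K | ∃ c ∈ ca A, ∃ x ∈ ca A, x ≠ 0 ∧ (∀ c' ∈ ca A, c' * x⁻¹ ∈ O) ∧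 y = c * x⁻¹}); let nrm : Subalgebra k K → Subalgebra k K := fun B => Algebra.adjoin k {y : K | IsIntegral ↥B y}; let tower : Subalgebra k K → ℕ → Subalgebra k K := fun A m => @Nat.rec (fun _ => Subalgebra k K) (loc A) (fun _ B => loc (nrm (chart B))) m; let Shape : Subalgebra k K → Prop := fun T => (∃ B : Subalgebra k K, B.FG ∧ B ≤ T ∧ loc B = T ∧ ∀ t ∈ T, ∃ b ∈ B, ∃ s ∈ B, s⁻¹ ∈ O ∧ t = b * s⁻¹) ∧ IsNoetherianRing ↥T ∧ T.toSubring ≤ O.toSubring ∧ ∀ s ∈ T, s⁻¹ ∈ O → s⁻¹ ∈ T; (∀ m : ℕ, Shape (tower A m)) → ∀ m : ℕ, (∀ n : ℕ, m ≤ n → ¬ IsRegularLocalRing ↥(tower A n)) → (∀ n : ℕ, m ≤ n → ¬ ringKrullDim ↥(tower A n) ≤ 1) → (∃ m' : ℕ, m < m' ∧ ∃ y ∈ ca (tower A m'), y ≠ 0 ∧ ∀ x ∈ ca (tower A m), x ≠ 0 → y * x⁻¹ ∉ O) ∨ ∃ n : ℕ, m ≤ n ∧ tower A (n + 1) = tower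 A n) → StrictDrop := by
  intro hA p hp k K _ _ _ _ O A hk hfg hfrac hle ca loc chart nrm tower m hm
  have hshape := TowerShape.stub_towerShape p hp k K O A hk hfg hfrac hle
  -- SC from the singular stage `m` to any regular stage `n ≥ m`, which is then later than `m`
  have hSC : ∀ n : ℕ, m ≤ n → IsRegularLocalRing ↥(tower A n) → ∃ m' : ℕ, m < m' ∧
      ∃ y ∈ ca (tower A m'), y ≠ 0 ∧ ∀ x ∈ ca (tower A m), x ≠ 0 → y * x⁻¹ ∉ O := by
    intro n hmn hreg
    have hne : m ≠ n := by
      rintro rfl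
      exact hm hreg
    obtain ⟨y, hy, hy0, hval⟩ :=
      RegularDrop.stub_regular_drop p hp k K O A hk hfg hfrac hle hshape m n hm hreg
    exact ⟨n, lt_of_le_of_ne hmn hne, y, hy, hy0, hval⟩
  by_cases hgood : ∃ n : ℕ, m ≤ n ∧
      (IsRegularLocalRing ↥(tower A n) ∨ ringKrullDim ↥(tower A n) ≤ 1)
  · obtain ⟨n, hmn, hn⟩ := hgood
    by_cases hreg : IsRegularLocalRing ↥(tower A n)
    · exact hSC n hmn hreg
    · exact hSC (n + 1) (Nat.le_succ_of_le hmn)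
        (DimLEOne.stub_dimLEOne_succ_regular p hp k K O A hk hfg hfrac hle hshape n
          (hn.resolve_left hreg) hreg)
  · push Not at hgood
    rcases hA p hp k K O A hk hfg hfrac hle hshape m (fun n hmn => (hgood n hmn).1)
        (fun n hmn => not_le.mpr (hgood n hmn).2) with hdrop | ⟨n, hmn, hstat⟩
    · exact hdrop
    · exact absurd (stationary_regular p hp k K O A hk hfg hfrac hle hshape n hstat) (hgood n hmn).1

/-- **The kernel from the crux** (left branch at the singular stage `m`; the extra hypotheses are
discarded), so that the remaining registered stub IS the crux. [folklore] -/
theorem dichotomy_dimGETwo_of_strictDrop (hD : StrictDrop) : ∀ p : ℕ, p.Prime → ∀ (k K : Type) [Field k] [CharP k p] [Field K] [Algebra k K] (O : ValuationSubring K) (A : Subalgebra k K), (∀ c : k, algebraMap k K c ∈ O) → A.FG → IsFractionRing ↥A K → A.toSubring ≤ O.toSubring → let ca : Subalgebra k K → Set K := fun A => {x : K | ∃ hx : x ∈ A, ∃ n : ℕ, ∀ i : ℕ, n ≤ i → ∀ (M N : ModuleCat.{0} ↥A), Module.Finite ↥A M → Module.Finite ↥A N → ∀ e : CategoryTheory.Abelian.Ext.{0}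 M N i, (⟨x, hx⟩ : ↥A) • e = 0}; let loc : Subalgebra k K → Subalgebra k K := fun A => Algebra.adjoin k {y : K | ∃ a ∈ A, ∃ s ∈ A, s⁻¹ ∈ O ∧ y = a * s⁻¹}; let chart : Subalgebra k K → Subalgebra k K := fun A => Algebra.adjoin k ((A : Set K) ∪ {y : K | ∃ c ∈ ca A, ∃ x ∈ ca A, x ≠ 0 ∧ (∀ c' ∈ ca A, c' * x⁻¹ ∈ O) ∧ y = c * x⁻¹}); let nrm : Subalgebra k K → Subalgebra k K := fun B => Algebra.adjoin k {y : K | IsIntegral ↥B y}; let tower : Subalgebra k K → ℕ → Subalgebra k K := fun A m => @Nat.rec (fun _ => Subalgebra k K) (loc A) (fun _ B => loc (nrm (chart B))) m; let Shape : Subalgebra k K → Prop := fun T => (∃ B : Subalgebra k K, B.FG ∧ B ≤ T ∧ loc B = T ∧ ∀ t ∈ T, ∃ b ∈ B, ∃ s ∈ B, s⁻¹ ∈ O ∧ t = b * s⁻¹) ∧ IsNoetherianRing ↥T ∧ T.toSubring ≤ O.toSubring ∧ ∀ s ∈ T, s⁻¹ ∈ O → s⁻¹ ∈ T; (∀ m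 : ℕ, Shape (tower A m)) → ∀ m : ℕ, (∀ n : ℕ, m ≤ n → ¬ IsRegularLocalRing ↥(tower A n)) → (∀ n : ℕ, m ≤ n → ¬ ringKrullDim ↥(tower A n) ≤ 1) → (∃ m' : ℕ, m < m' ∧ ∃ y ∈ ca (tower A m'), y ≠ 0 ∧ ∀ x ∈ ca (tower A m), x ≠ 0 → y * x⁻¹ ∉ O) ∨ ∃ n : ℕ, m ≤ n ∧ tower A (n + 1) = tower A n := by
  intro p hp k K _ _ _ _ O A hk hfg hfrac hle ca loc chart nrm tower Shape _ m hsing _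
  exact Or.inl (hD p hp k K O A hk hfg hfrac hle m (hsing m le_rfl))

/-- **`stub_dichotomy_dimGETwo ↔ StrictDrop`, unconditionally**: after this file the crux
`StrictDrop` (stmt-ResolutionOfSingularities-16485) is reduced to EXACTLY its one open registered stub —
no sideways growth for ever, at constant minimal conductor value, of a canonical tower all of whose
stages are singular of dimension `≥ 2`. [cite: IyengarTakahashi2014, Thm. 5.4] -/
theorem dichotomy_dimGETwo_iff_strictDrop : (∀ p : ℕ, p.Prime → ∀ (k K : Type) [Field k] [CharP k p] [Field K] [Algebra k K] (O : ValuationSubring K) (A : Subalgebra k K), (∀ c : k, algebraMap k K c ∈ O) → A.FG → IsFractionRing ↥A K → A.toSubring ≤ O.toSubring → let ca : Subalgebra k K → Set K := fun A => {x : K | ∃ hx : x ∈ A, ∃ n : ℕ, ∀ i : ℕ, n ≤ i → ∀ (M N : ModuleCat.{0} ↥A), Module.Finite ↥A M → Module.Finite ↥A N → ∀ e : CategoryTheory.Abelian.Ext.{0} M N i, (⟨x, hx⟩ : ↥A) • e = 0}; let loc : Subalgebra k K → Subalgebra k K := fun A => Algebra.adjoin k {y : K | ∃ a ∈ A, ∃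 s ∈ A, s⁻¹ ∈ O ∧ y = a * s⁻¹}; let chart : Subalgebra k K → Subalgebra k K := fun A => Algebra.adjoin k ((A : Set K) ∪ {y : K | ∃ c ∈ ca A, ∃ x ∈ ca A, x ≠ 0 ∧ (∀ c' ∈ ca A, c' * x⁻¹ ∈ O) ∧ y = c * x⁻¹}); let nrm : Subalgebra k K → Subalgebra k K := fun B => Algebra.adjoin k {y : K | IsIntegral ↥B y}; let tower : Subalgebra k K → ℕ → Subalgebra k K := fun A m => @Nat.rec (fun _ => Subalgebra k K) (loc A) (fun _ B => loc (nrm (chart B))) m; let Shape : Subalgebra k K → Prop := fun T => (∃ B : Subalgebra k K, B.FG ∧ B ≤ T ∧ loc B = T ∧ ∀ t ∈ T, ∃ b ∈ B, ∃ s ∈ B, s⁻¹ ∈ O ∧ t = b * s⁻¹) ∧ IsNoetherianRing ↥T ∧ T.toSubring ≤ O.toSubring ∧ ∀ s ∈ T, s⁻¹ ∈ O → s⁻¹ ∈ T; (∀ m : ℕ, Shape (tower A m)) → ∀ m : ℕ, (∀ n : ℕ, m ≤ n → ¬ IsRegularLocalRing ↥(tower A n)) → (∀ n : ℕ, m ≤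 n → ¬ ringKrullDim ↥(tower A n) ≤ 1) → (∃ m' : ℕ, m < m' ∧ ∃ y ∈ ca (tower A m'), y ≠ 0 ∧ ∀ x ∈ ca (tower A m), x ≠ 0 → y * x⁻¹ ∉ O) ∨ ∃ n : ℕ, m ≤ n ∧ tower A (n + 1) = tower A n) ↔ StrictDrop :=
  ⟨strictDrop_of_dichotomy_dimGETwo, dichotomy_dimGETwo_of_strictDrop⟩

end Summit.ResolutionOfSingularities.ResolutionOfSingularities.Theorems.StrictDrop.Birth.KernelIff

end
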